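import Summits.QuantumFields.YangMills.Theorems.LuscherReductionOneSiteLevelsValleyAlgebra
import Summits.QuantumFields.YangMills.Theorems.LuscherReductionOneSiteLevelsNormaliser
import Summits.QuantumFields.YangMills.Theorems.LuscherReductionOneSiteLevelsGnForms
import Summits.QuantumFields.YangMills.Theorems.LuscherReductionOneSiteLevelsGaussForm
import Summits.QuantumFields.YangMills.Theorems.FemtoTransferGapBounds

/-!
# VALLEY, step 2: the FAR supersolution bounds and the Gaussian size of `linkCE`
# (support module for `stub_absUpperValleyMag` of crux `OneSiteLevels`, route `LuscherReduction`, item stmt-QuantumFields-20007;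
# fleet lead prover ym-luscher-20007-p1 g2)

The VALLEY line bounds the transfer form on the valley region by weighted Schur tests, weight `h = e^{−τBS}` (`τ = 1/(8t)` below the
pigeonholed radius `t`, `τ = 0` above).  The supersolution quantity is

  `J_τ(U) := (K_B h)(U)/h(U) = e^{(τ−½)BS(U)} ∫ E_B(U,V) e^{−(½+τ)BS(V)} dV`,   `E_B = e^{B Σ_e Re tr(U_eV_e⁻¹)}` (`linkE`).

This file proves the two FAR cases (the point `U` has `B·S(U) ≥ T₀`), where no Laplace asymptotics is needed:
* §1 left translation `V = U·W` of the a-priori measure (`integral_comp_mul_left_cfg`) and the kinetic integral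
  `∫ e^{−a·D(W)} dW = (e^{−2a} c(a))³ ≤ √(π/a)⁹/(2π²)³` (`integral_exp_neg_mul_sumDefect_le`), `D(W) = Σ_e(2 − Re tr W_e)`;
* §2 the SHARP Gaussian lower bound on the normaliser, `(1 − 27/B)·e^{6B}√(π/B)⁹/(2π²)³ ≤ linkCE B` (`gauss_le_linkCE`), from the all-upper
  gnomonic chart, `Π(1+|y_i|²)^{-2} ≥ 1 − 6‖y‖²`, `1/√(1+s) ≥ 1 − s/2` and the Gaussian moments of `Theorems.…GaussForm`;
* §3 FAR, lower shell: under `16(½+τ)²ρ(U)² + 2√2(½+τ)√S(U) ≤ ½` the global exponent bound `valley_exponent_le` gives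
  `J_τ(U) ≤ 16√2 · e^{−BS(U)/2} · e^{6B}√(π/B)⁹/(2π²)³` (`valleyJ_le_of_far`);
* §4 FAR, upper shell (`τ = 0`): `J_0(U) ≤ e^{−BS(U)/2} · linkCE B` (`valleyJ_zero_le`).

## WHAT THIS IS NOT
Not the NEAR (Laplace) case, not the valley estimate, NOT the crux, NOT THE CLAY GAP.  Sorry-free; no new definition, no named fact.
-/

set_option autoImplicit false

noncomputable section

open MeasureTheory Filter Topology Real
open scoped Matrix Quaternion RealInnerProductSpace
open Literature.MathematicalPhysics.QuantumFieldTheory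
open Literature.MathematicalPhysics.QuantumLattice
open Literature.Analysis.OperatorTheory.YMMatrixModel
open Literature.MathematicalPhysics.QuantumFieldTheory.Balaban1983to89.T4CubeChartGnomonic (gnoPoint)

namespace Summit.QuantumFields.YangMills.Theorems.FemtoTransferGap

/-! ### §1. Left translation and the kinetic integral -/

/-- The one-site a-priori measure is left invariant (product of Haar measures). [folklore] -/
theorem isMulLeftInvariant_configMeasure : (configMeasure SU2 1).IsMulLeftInvariant := by
  unfold configMeasure; infer_instance

/-- **Left translation**: `∫ F(V) dV = ∫ F(U·W) dW` for the one-site a-priori measure. [folklore] -/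
theorem integral_comp_mul_left_cfg (F : Cfg → ℝ) (U : Cfg) :
    ∫ V, F V ∂(configMeasure SU2 1) = ∫ W, F (U * W) ∂(configMeasure SU2 1) := by
  haveI := isMulLeftInvariant_configMeasure
  exact (integral_mul_left_eq_self F U).symm

/-- The kinetic factor after translation: `E_B(U, U·W) = exp(6B − B·D(W))`, `D(W) = Σ_e (2 − Re tr W_e)`. [cite: Luscher1983, §2] -/
theorem linkE_mul_eq (B : ℝ) (U W : Cfg) :
    linkE B U (U * W) = Real.exp (6 * B - B * ∑ e : Edge 3 1, (2 - 2 * scalarPart (W e))) := by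
  rw [linkE_eq_exp, timeCoupling_mul_eq]
  congr 1; ring

/-- `D(W) ≥ 0`. [folklore] -/
theorem sumDefect_nonneg (W : Cfg) : 0 ≤ ∑ e : Edge 3 1, (2 - 2 * scalarPart (W e)) :=
  Finset.sum_nonneg fun _ _ => two_sub_two_mul_scalarPart_nonneg _

/-- `W ↦ D(W)` is measurable. [folklore] -/
theorem measurable_sumDefect : Measurable fun W : Cfg => ∑ e : Edge 3 1, (2 - 2 * scalarPart (W e)) := by
  refine Finset.measurable_sum _ fun e _ => measurable_const.sub (measurable_const.mul ?_)
  exact continuous_scalarPart.measurable.comp (measurable_pi_apply e)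

/-- `exp(−a(2 − 2w₀)) = e^{−2a}·w_a(W)` (`w_a = linkW a`). [folklore] -/
theorem exp_neg_mul_defect_eq (a : ℝ) (W : SU2) :
    Real.exp (-(a * (2 - 2 * scalarPart W))) = Real.exp (-(2 * a)) * linkW a W := by
  rw [linkW, re_trace_eq_two_mul_scalarPart, ← Real.exp_add]
  congr 1; ring

/-- **The kinetic integral**: `∫ e^{−a·D(W)} dW = (e^{−2a} c(a))³`. [folklore] -/
theorem integral_exp_neg_mul_sumDefect (a : ℝ) :
    ∫ W, Real.exp (-(a * ∑ e : Edge 3 1, (2 - 2 * scalarPart (W e)))) ∂(configMeasure SU2 1)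
      = (Real.exp (-(2 * a)) * linkC a) ^ 3 := by
  have hprod : ∀ W : Cfg, Real.exp (-(a * ∑ e : Edge 3 1, (2 - 2 * scalarPart (W e))))
      = ∏ e : Edge 3 1, (Real.exp (-(2 * a)) * linkW a (W e)) := by
    intro W
    rw [Finset.mul_sum, ← Finset.sum_neg_distrib, Real.exp_sum]
    exact Finset.prod_congr rfl fun e' _ => exp_neg_mul_defect_eq a (W e')
  simp_rw [hprod]
  rw [show (∫ W : Cfg, ∏ e : Edge 3 1, Real.exp (-(2 * a)) * linkW a (W e) ∂configMeasure SU2 1)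
      = ∏ e : Edge 3 1, ∫ w, Real.exp (-(2 * a)) * linkW a w ∂haarProbability SU2 from
    integral_fintype_prod_eq_prod (fun (_ : Edge 3 1) w => Real.exp (-(2 * a)) * linkW a w)]
  simp_rw [integral_const_mul]
  rw [Finset.prod_const, Finset.card_univ]
  rfl

/-- `∫ e^{−a·D(W)} dW ≤ √(π/a)⁹/(2π²)³` for `a > 0` (the sharp Gaussian bound `linkC_le_gauss`, cubed). [folklore] -/
theorem integral_exp_neg_mul_sumDefect_le {a : ℝ} (ha : 0 < a) :
    ∫ W, Real.exp (-(a * ∑ e : Edge 3 1, (2 - 2 * scalarPart (W e)))) ∂(configMeasure SU2 1)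
      ≤ Real.sqrt (π / a) ^ 9 / (2 * π ^ 2) ^ 3 := by
  rw [integral_exp_neg_mul_sumDefect]
  have h := linkC_le_gauss ha
  have h0 : 0 ≤ Real.exp (-(2 * a)) * linkC a := mul_nonneg (Real.exp_pos _).le (linkC_pos ha.le).le
  have hee : Real.exp (-(2 * a)) * Real.exp (2 * a) = 1 := by rw [← Real.exp_add, neg_add_cancel, Real.exp_zero]
  have h1 : Real.exp (-(2 * a)) * linkC a ≤ Real.sqrt (π / a) ^ 3 / (2 * π ^ 2) := by
    calc Real.exp (-(2 * a)) * linkC a ≤ Real.exp (-(2 * a)) * (Real.exp (2 * a) * Real.sqrt (π / a) ^ 3 / (2 * π ^ 2)) :=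
          mul_le_mul_of_nonneg_left h (Real.exp_pos _).le
      _ = (Real.exp (-(2 * a)) * Real.exp (2 * a)) * Real.sqrt (π / a) ^ 3 / (2 * π ^ 2) := by ring
      _ = Real.sqrt (π / a) ^ 3 / (2 * π ^ 2) := by rw [hee, one_mul]
  calc (Real.exp (-(2 * a)) * linkC a) ^ 3 ≤ (Real.sqrt (π / a) ^ 3 / (2 * π ^ 2)) ^ 3 := pow_le_pow_left₀ h0 h1 3
    _ = Real.sqrt (π / a) ^ 9 / (2 * π ^ 2) ^ 3 := by rw [div_pow, ← pow_mul]

/-! ### §2. The sharp Gaussian lower bound on `linkCE` -/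

/-- `∫ ‖y‖² e^{−B‖y‖²} dy = n √(π/B)^n/(2B)` on `ℝⁿ`. [folklore] -/
theorem integral_norm_sq_mul_exp_neg_mul_sq_norm {ι : Type*} [Fintype ι] [DecidableEq ι] {B : ℝ} (hB : 0 < B) :
    ∫ y : EuclideanSpace ℝ ι, ‖y‖ ^ 2 * Real.exp (-B * ‖y‖ ^ 2)
      = Fintype.card ι * (Real.sqrt (π / B) ^ Fintype.card ι / (2 * B)) := by
  have e : ∀ y : EuclideanSpace ℝ ι, ‖y‖ ^ 2 * Real.exp (-B * ‖y‖ ^ 2)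
      = ∑ k, ⟪EuclideanSpace.single k (1 : ℝ), y⟫ ^ 2 * Real.exp (-B * ‖y‖ ^ 2) := by
    intro y
    rw [← Finset.sum_mul, EuclideanSpace.norm_sq_eq]
    congr 1
    refine Finset.sum_congr rfl fun k _ => ?_
    rw [EuclideanSpace.inner_single_left, map_one, one_mul, Real.norm_eq_abs, sq_abs]
  simp_rw [e]
  rw [integral_finsetSum _ fun k _ => GaussForm.integrable_inner_sq_mul_gauss hB _]
  simp_rw [GaussForm.integral_inner_sq_mul_exp_neg_mul_sq_norm hB, PiLp.norm_single, norm_one, one_pow, one_mul]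
  rw [Finset.sum_const, Finset.card_univ, nsmul_eq_mul]

/-- `1/√(1+s) ≥ 1 − s/2` for `s ≥ 0`. [folklore] -/
theorem one_sub_half_le_inv_sqrt {s : ℝ} (hs : 0 ≤ s) : 1 - s / 2 ≤ (Real.sqrt (1 + s))⁻¹ := by
  have h1 : 0 < Real.sqrt (1 + s) := Real.sqrt_pos.2 (by linarith)
  rw [inv_eq_one_div, le_div_iff₀ h1]
  rcases le_or_gt (1 - s / 2) 0 with hneg | hpos
  · nlinarith [h1]
  · have hsq : Real.sqrt (1 + s) ^ 2 = 1 + s := Real.sq_sqrt (by linarith)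
    have key : ((1 - s / 2) * Real.sqrt (1 + s)) ^ 2 ≤ 1 := by
      rw [mul_pow, hsq]; nlinarith [sq_nonneg s]
    nlinarith [key, mul_pos hpos h1]

/-- In the all-upper gnomonic chart the kinetic defect is at most the flat square: `D(gnChart 1 σ₀ y) ≤ ‖y‖²`
(`σ₀ ≡ false`; `2 − 2/√(1+|y_i|²) ≤ |y_i|²`). [folklore] -/
theorem sumDefect_gnChart_le (y : ZM) :
    ∑ e : Edge 3 1, (2 - 2 * scalarPart (gnChart 1 (fun _ => false) y e)) ≤ ‖y‖ ^ 2 := by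
  rw [sum_edge_eq_sum_fin, norm_sq_eq_sum_csq]
  refine Finset.sum_le_sum fun i _ => ?_
  have hchart : gnChart 1 (fun _ => false) y (edgeOf i) = gnoPoint (fun a => 1 * y (i, a)) := by
    simp [gnChart, hemi, edgeOf]
  rw [hchart, scalarPart_gnoPoint]
  have hn : ‖gnomonicQuat (fun a => 1 * y (i, a))‖ = Real.sqrt (1 + csq i y) := by
    rw [← Real.sqrt_sq (norm_nonneg (gnomonicQuat (fun a => 1 * y (i, a)))), norm_gnomonicQuat_sq, vsq_block, one_pow, one_mul]
  rw [hn]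
  have := one_sub_half_le_inv_sqrt (csq_nonneg i y)
  linarith

/-- **Sharp Gaussian lower bound on the normaliser**: `(1 − 27/B) · e^{6B} √(π/B)⁹/(2π²)³ ≤ linkCE B` (`B > 0`).
[cite: MontvayMunster1994, §3.2.3 (3.97) p.121] -/
theorem gauss_le_linkCE {B : ℝ} (hB : 0 < B) :
    (1 - 27 / B) * (Real.exp (6 * B) * Real.sqrt (π / B) ^ 9 / (2 * π ^ 2) ^ 3) ≤ linkCE B := by
  -- `linkCE B = ∫ e^{6B − B D(W)} dW`
  set g : Cfg → ℝ := fun W => Real.exp (6 * B - B * ∑ e : Edge 3 1, (2 - 2 * scalarPart (W e))) with hgdef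
  have h1 : linkCE B = ∫ W, g W ∂configMeasure SU2 1 := by
    rw [← integral_linkE_snd B 1]
    refine integral_congr_ae (ae_of_all _ fun W => ?_)
    rw [hgdef]; dsimp only
    rw [← linkE_mul_eq B 1 W, one_mul]
  have hgm : Measurable g := Real.measurable_exp.comp (measurable_const.sub (measurable_const.mul measurable_sumDefect))
  have hg0 : ∀ W, 0 ≤ g W := fun W => (Real.exp_pos _).le
  have hgle : ∀ W, g W ≤ Real.exp (6 * B) := fun W => Real.exp_le_exp.2 (by nlinarith [sumDefect_nonneg W, hB])
  have hgb : ∃ C : ℝ, ∀ W, |g W| ≤ C := ⟨Real.exp (6 * B), fun W => by rw [abs_of_nonneg (hg0 W)]; exact hgle W⟩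
  -- chart decomposition; keep the all-upper pattern
  have hchart := integral_configMeasure_eq_sum_gnChart one_pos hgm hgb
  have hterm0 : ∀ σ : Fin 3 → Bool, 0 ≤ ∫ y, gnDensityReal 1 y * g (gnChart 1 σ y) :=
    fun σ => integral_nonneg fun y => mul_nonneg (gnDensityReal_pos one_pos y).le (hg0 _)
  have hge : ∫ y, gnDensityReal 1 y * g (gnChart 1 (fun _ => false) y) ≤ linkCE B := by
    rw [h1, hchart]
    exact Finset.single_le_sum (f := fun σ : Fin 3 → Bool => ∫ y, gnDensityReal 1 y * g (gnChart 1 σ y))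
      (fun σ _ => hterm0 σ) (Finset.mem_univ _)
  refine le_trans ?_ hge
  -- pointwise lower bound of the integrand
  have hpt : ∀ y : ZM, ((2 * π ^ 2)⁻¹) ^ 3 * ((1 - 6 * ‖y‖ ^ 2) * (Real.exp (6 * B) * Real.exp (-B * ‖y‖ ^ 2)))
      ≤ gnDensityReal 1 y * g (gnChart 1 (fun _ => false) y) := by
    intro y
    have hglow : Real.exp (6 * B) * Real.exp (-B * ‖y‖ ^ 2) ≤ g (gnChart 1 (fun _ => false) y) := by
      rw [hgdef]; dsimp only
      rw [← Real.exp_add]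
      exact Real.exp_le_exp.2 (by nlinarith [sumDefect_gnChart_le y, hB])
    have hdens : gnDensityReal 1 y = ((2 * π ^ 2)⁻¹) ^ 3 * ∏ i : Fin 3, gnC 1 y i ^ 2 := by
      rw [gnDensityReal_eq]; ring
    have hprod := one_sub_le_prod_gnC_sq 1 y
    rw [one_pow, one_mul] at hprod
    have hprod0 : 0 ≤ ∏ i : Fin 3, gnC 1 y i ^ 2 := Finset.prod_nonneg fun i _ => sq_nonneg _
    have hc0 : (0 : ℝ) ≤ ((2 * π ^ 2)⁻¹) ^ 3 := by positivity
    have hE0 : 0 ≤ Real.exp (6 * B) * Real.exp (-B * ‖y‖ ^ 2) := by positivity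
    rw [hdens, mul_assoc]
    refine mul_le_mul_of_nonneg_left ?_ hc0
    rcases le_or_gt 0 (1 - 6 * ‖y‖ ^ 2) with hnn | hneg
    · exact mul_le_mul hprod hglow hE0 hprod0
    · have : (1 - 6 * ‖y‖ ^ 2) * (Real.exp (6 * B) * Real.exp (-B * ‖y‖ ^ 2)) ≤ 0 :=
        mul_nonpos_of_nonpos_of_nonneg hneg.le hE0
      exact this.trans (mul_nonneg hprod0 (hg0 _))
  -- integrate the lower bound
  have hcard : Fintype.card (Fin 3 × Fin 3) = 9 := by simp
  have hI0 := GaussForm.integral_exp_neg_mul_sq_norm (ι := Fin 3 × Fin 3) hB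
  have hI2 := integral_norm_sq_mul_exp_neg_mul_sq_norm (ι := Fin 3 × Fin 3) hB
  rw [hcard] at hI0 hI2
  have hint0 : Integrable fun y : ZM => Real.exp (-B * ‖y‖ ^ 2) := GaussForm.integrable_gauss hB
  have hint2 : Integrable fun y : ZM => ‖y‖ ^ 2 * Real.exp (-B * ‖y‖ ^ 2) := GaussForm.integrable_normSq_mul_gauss hB
  have hlow_int : Integrable fun y : ZM =>
      ((2 * π ^ 2)⁻¹) ^ 3 * ((1 - 6 * ‖y‖ ^ 2) * (Real.exp (6 * B) * Real.exp (-B * ‖y‖ ^ 2))) := by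
    have : (fun y : ZM => ((2 * π ^ 2)⁻¹) ^ 3 * ((1 - 6 * ‖y‖ ^ 2) * (Real.exp (6 * B) * Real.exp (-B * ‖y‖ ^ 2))))
        = fun y => ((2 * π ^ 2)⁻¹) ^ 3 * Real.exp (6 * B) * Real.exp (-B * ‖y‖ ^ 2)
          - 6 * ((2 * π ^ 2)⁻¹) ^ 3 * Real.exp (6 * B) * (‖y‖ ^ 2 * Real.exp (-B * ‖y‖ ^ 2)) := by
      funext y; ring
    rw [this]
    exact (hint0.const_mul _).sub (hint2.const_mul _)
  have hup_int : Integrable fun y : ZM => gnDensityReal 1 y * g (gnChart 1 (fun _ => false) y) := by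
    have hm : AEStronglyMeasurable (fun y : ZM => g (gnChart 1 (fun _ => false) y)) volume :=
      (hgm.comp (measurable_gnChart 1 _)).aestronglyMeasurable
    have h := (integrable_gnDensityReal one_pos).bdd_mul hm (c := Real.exp (6 * B))
      (ae_of_all _ fun y => by rw [Real.norm_eq_abs, abs_of_nonneg (hg0 _)]; exact hgle _)
    simpa only [mul_comm] using h
  have hmono := integral_mono hlow_int hup_int hpt
  refine le_trans (le_of_eq ?_) hmono
  -- evaluate the Gaussian integral
  have e : ∫ y : ZM, ((2 * π ^ 2)⁻¹) ^ 3 * ((1 - 6 * ‖y‖ ^ 2) * (Real.exp (6 * B) * Real.exp (-B * ‖y‖ ^ 2)))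
      = ((2 * π ^ 2)⁻¹) ^ 3 * Real.exp (6 * B) * (∫ y : ZM, Real.exp (-B * ‖y‖ ^ 2))
        - 6 * ((2 * π ^ 2)⁻¹) ^ 3 * Real.exp (6 * B) * ∫ y : ZM, ‖y‖ ^ 2 * Real.exp (-B * ‖y‖ ^ 2) := by
    rw [← integral_const_mul, ← integral_const_mul, ← integral_sub (hint0.const_mul _) (hint2.const_mul _)]
    refine integral_congr_ae (ae_of_all _ fun y => ?_)
    ring
  rw [e, hI0, hI2]
  field_simp
  ring

/-- `V ↦ E_B(U,V)` is measurable. [folklore] -/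
theorem measurable_linkE_right (B : ℝ) (U : Cfg) : Measurable fun V : Cfg => linkE B U V := by
  unfold linkE
  refine Finset.measurable_prod _ fun e _ => (measurable_linkW B).comp ?_
  exact measurable_const.mul (measurable_pi_apply e).inv

/-- `W ↦ E_B(U, U·W)` is measurable. [folklore] -/
theorem measurable_linkE_mul (B : ℝ) (U : Cfg) : Measurable fun W : Cfg => linkE B U (U * W) := by
  have e : (fun W : Cfg => linkE B U (U * W)) = fun W => Real.exp (6 * B - B * ∑ e : Edge 3 1, (2 - 2 * scalarPart (W e))) :=
    funext fun W => linkE_mul_eq B U W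
  rw [e]
  exact Real.measurable_exp.comp (measurable_const.sub (measurable_const.mul measurable_sumDefect))

/-! ### §3. FAR, lower shell: `J_τ(U) ≤ 16√2 e^{−BS(U)/2} · e^{6B}√(π/B)⁹/(2π²)³` -/

/-- The integrand of `J_τ(U)` after translation is bounded by `exp(B(6 − S(U)/2 − D(W)/2))` as soon as
`16(½+τ)²ρ(U)² + 2√2(½+τ)√S(U) ≤ ½` (the lower-shell hypothesis; `valley_exponent_le`). [cite: SimonB1983DiscreteSpectrum, §2] -/
theorem valleyJ_integrand_le {B τ : ℝ} (hB : 0 < B) (hτ : 0 ≤ 1 / 2 + τ) (U W : Cfg)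
    (hU : 16 * (1 / 2 + τ) ^ 2 * ‖zmCoord 1 U‖ ^ 2 + 2 * Real.sqrt 2 * (1 / 2 + τ) * √(wilsonAction su2Rep U) ≤ 1 / 2) :
    Real.exp ((τ - 1 / 2) * B * wilsonAction su2Rep U) *
        (linkE B U (U * W) * Real.exp (-(1 / 2 + τ) * B * wilsonAction su2Rep (U * W)))
      ≤ Real.exp (6 * B) * Real.exp (-(B / 2) * wilsonAction su2Rep U)
        * Real.exp (-(B / 2 * ∑ e : Edge 3 1, (2 - 2 * scalarPart (W e)))) := by
  rw [linkE_eq_exp, ← Real.exp_add, ← Real.exp_add, ← Real.exp_add, ← Real.exp_add]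
  refine Real.exp_le_exp.2 ?_
  have h := valley_exponent_le τ hτ U W
  have hD0 := sumDefect_nonneg W
  have hcoef : (∑ e : Edge 3 1, (2 - 2 * scalarPart (W e))) * (1 / 2) ≤
      (∑ e : Edge 3 1, (2 - 2 * scalarPart (W e)))
        * (1 - 16 * (1 / 2 + τ) ^ 2 * ‖zmCoord 1 U‖ ^ 2 - 2 * Real.sqrt 2 * (1 / 2 + τ) * √(wilsonAction su2Rep U)) :=
    mul_le_mul_of_nonneg_left (by linarith) hD0
  have h2 : (τ - 1 / 2) * wilsonAction su2Rep U + timeCoupling su2Rep U (U * W)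
      - (1 / 2 + τ) * wilsonAction su2Rep (U * W)
      ≤ 6 - wilsonAction su2Rep U / 2 - (∑ e : Edge 3 1, (2 - 2 * scalarPart (W e))) * (1 / 2) := by linarith
  have h3 := mul_le_mul_of_nonneg_left h2 hB.le
  have e1 : (τ - 1 / 2) * B * wilsonAction su2Rep U + (B * timeCoupling su2Rep U (U * W)
      + -(1 / 2 + τ) * B * wilsonAction su2Rep (U * W))
      = B * ((τ - 1 / 2) * wilsonAction su2Rep U + timeCoupling su2Rep U (U * W)
        - (1 / 2 + τ) * wilsonAction su2Rep (U * W)) := by ring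
  have e2 : 6 * B + -(B / 2) * wilsonAction su2Rep U + -(B / 2 * ∑ e : Edge 3 1, (2 - 2 * scalarPart (W e)))
      = B * (6 - wilsonAction su2Rep U / 2 - (∑ e : Edge 3 1, (2 - 2 * scalarPart (W e))) * (1 / 2)) := by ring
  rw [e1, e2]
  linarith [h3]

/-- **FAR, lower shell.**  For `B > 0`, `½ + τ ≥ 0` and a point `U` of the lower shell
(`16(½+τ)²ρ(U)² + 2√2(½+τ)√S(U) ≤ ½`): `J_τ(U) ≤ 16√2 · e^{−BS(U)/2} · e^{6B}√(π/B)⁹/(2π²)³`; with `gauss_le_linkCE` this is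
`≤ 16√2 (1 − 27/B)⁻¹ e^{−BS(U)/2} · linkCE B`, i.e. `< linkCE B` once `B·S(U) ≥ 10`, `B ≥ 54`. [cite: SimonB1983DiscreteSpectrum, §2] -/
theorem valleyJ_le_of_far {B τ : ℝ} (hB : 0 < B) (hτ : 0 ≤ 1 / 2 + τ) (U : Cfg)
    (hU : 16 * (1 / 2 + τ) ^ 2 * ‖zmCoord 1 U‖ ^ 2 + 2 * Real.sqrt 2 * (1 / 2 + τ) * √(wilsonAction su2Rep U) ≤ 1 / 2) :
    Real.exp ((τ - 1 / 2) * B * wilsonAction su2Rep U) *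
        ∫ V, linkE B U V * Real.exp (-(1 / 2 + τ) * B * wilsonAction su2Rep V) ∂(configMeasure SU2 1)
      ≤ 16 * Real.sqrt 2 * Real.exp (-(B / 2) * wilsonAction su2Rep U)
        * (Real.exp (6 * B) * Real.sqrt (π / B) ^ 9 / (2 * π ^ 2) ^ 3) := by
  have htr := integral_comp_mul_left_cfg (fun V => linkE B U V * Real.exp (-(1 / 2 + τ) * B * wilsonAction su2Rep V)) U
  rw [htr, ← integral_const_mul]
  -- integrability of both sides
  have hSm : Measurable fun W : Cfg => wilsonAction su2Rep (U * W) :=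
    (continuous_wilsonAction su2Rep continuous_su2Rep).measurable.comp (measurable_const.mul measurable_id)
  have hEm : Measurable fun W : Cfg => linkE B U (U * W) := measurable_linkE_mul B U
  have hS0 : ∀ W : Cfg, 0 ≤ wilsonAction su2Rep (U * W) := fun W => wilsonAction_su2_nonneg _
  have hint1 : Integrable (fun W : Cfg => Real.exp ((τ - 1 / 2) * B * wilsonAction su2Rep U) *
      (linkE B U (U * W) * Real.exp (-(1 / 2 + τ) * B * wilsonAction su2Rep (U * W)))) (configMeasure SU2 1) := by
    refine integrable_configMeasure_of_bounded ((measurable_const.mul (hEm.mul (Real.measurable_exp.comp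
      (measurable_const.mul hSm))))) ⟨Real.exp ((τ - 1 / 2) * B * wilsonAction su2Rep U) *
        (Real.exp (2 * B) ^ Fintype.card (Edge 3 1) * 1), fun W => ?_⟩
    rw [abs_mul, abs_mul, abs_of_nonneg (Real.exp_pos _).le, abs_of_nonneg (linkE_pos B _ _).le,
      abs_of_nonneg (Real.exp_pos _).le]
    refine mul_le_mul_of_nonneg_left (mul_le_mul (linkE_le hB.le _ _) ?_ (Real.exp_pos _).le (by positivity))
      (Real.exp_pos _).le
    rw [Real.exp_le_one_iff]
    have := hS0 W
    have : 0 ≤ (1 / 2 + τ) * B * wilsonAction su2Rep (U * W) := by positivity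
    linarith
  have hint2 : Integrable (fun W : Cfg => Real.exp (6 * B) * Real.exp (-(B / 2) * wilsonAction su2Rep U)
      * Real.exp (-(B / 2 * ∑ e : Edge 3 1, (2 - 2 * scalarPart (W e))))) (configMeasure SU2 1) := by
    refine integrable_configMeasure_of_bounded (measurable_const.mul (Real.measurable_exp.comp
      (measurable_const.mul measurable_sumDefect).neg)) ⟨Real.exp (6 * B) * Real.exp (-(B / 2) * wilsonAction su2Rep U) * 1,
        fun W => ?_⟩
    rw [abs_of_nonneg (by positivity)]
    refine mul_le_mul_of_nonneg_left ?_ (by positivity)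
    rw [Real.exp_le_one_iff, neg_nonpos]
    exact mul_nonneg (by positivity) (sumDefect_nonneg W)
  have hmono := integral_mono hint1 hint2 fun W => valleyJ_integrand_le hB hτ U W hU
  refine hmono.trans ?_
  rw [integral_const_mul]
  have hkin := integral_exp_neg_mul_sumDefect_le (a := B / 2) (by positivity)
  have hsq : Real.sqrt (π / (B / 2)) ^ 9 = 16 * Real.sqrt 2 * Real.sqrt (π / B) ^ 9 := by
    rw [show π / (B / 2) = 2 * (π / B) by field_simp, Real.sqrt_mul (by norm_num : (0:ℝ) ≤ 2), mul_pow]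
    have h2 : Real.sqrt 2 ^ 9 = 16 * Real.sqrt 2 := by
      have h := Real.sq_sqrt (show (0:ℝ) ≤ 2 by norm_num)
      calc Real.sqrt 2 ^ 9 = (Real.sqrt 2 ^ 2) ^ 4 * Real.sqrt 2 := by ring
        _ = 16 * Real.sqrt 2 := by rw [h]; norm_num
    rw [h2]
  rw [hsq] at hkin
  have hpos : 0 ≤ Real.exp (6 * B) * Real.exp (-(B / 2) * wilsonAction su2Rep U) := by positivity
  calc Real.exp (6 * B) * Real.exp (-(B / 2) * wilsonAction su2Rep U)
        * ∫ W, Real.exp (-(B / 2 * ∑ e : Edge 3 1, (2 - 2 * scalarPart (W e)))) ∂configMeasure SU2 1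
      ≤ Real.exp (6 * B) * Real.exp (-(B / 2) * wilsonAction su2Rep U)
        * (16 * Real.sqrt 2 * Real.sqrt (π / B) ^ 9 / (2 * π ^ 2) ^ 3) := mul_le_mul_of_nonneg_left hkin hpos
    _ = 16 * Real.sqrt 2 * Real.exp (-(B / 2) * wilsonAction su2Rep U)
        * (Real.exp (6 * B) * Real.sqrt (π / B) ^ 9 / (2 * π ^ 2) ^ 3) := by ring

/-! ### §4. FAR, upper shell (`τ = 0`): `J_0(U) ≤ e^{−BS(U)/2} · linkCE B` -/

/-- **FAR, upper shell** (weight `h ≡ 1`): `e^{−BS(U)/2} ∫ E_B(U,V) e^{−BS(V)/2} dV ≤ e^{−BS(U)/2} · linkCE B`, since the magnetic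
factor at `V` is `≤ 1` and the kinetic row integral is `linkCE B`. [folklore] -/
theorem valleyJ_zero_le {B : ℝ} (hB : 0 < B) (U : Cfg) :
    Real.exp ((0 - 1 / 2) * B * wilsonAction su2Rep U) *
        ∫ V, linkE B U V * Real.exp (-(1 / 2 + 0) * B * wilsonAction su2Rep V) ∂(configMeasure SU2 1)
      ≤ Real.exp (-(B / 2) * wilsonAction su2Rep U) * linkCE B := by
  have e : (0 - 1 / 2) * B * wilsonAction su2Rep U = -(B / 2) * wilsonAction su2Rep U := by ring
  rw [e]
  refine mul_le_mul_of_nonneg_left ?_ (Real.exp_pos _).le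
  rw [← integral_linkE_snd B U]
  have hSm : Measurable fun V : Cfg => wilsonAction su2Rep V := (continuous_wilsonAction su2Rep continuous_su2Rep).measurable
  have hEm : Measurable fun V : Cfg => linkE B U V := measurable_linkE_right B U
  have hle1 : ∀ V : Cfg, Real.exp (-(1 / 2 + 0) * B * wilsonAction su2Rep V) ≤ 1 := fun V => by
    rw [Real.exp_le_one_iff]
    have := wilsonAction_su2_nonneg V
    have : 0 ≤ (1 / 2 + 0) * B * wilsonAction su2Rep V := by positivity
    linarith
  have hintE : Integrable (fun V : Cfg => linkE B U V) (configMeasure SU2 1) :=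
    integrable_configMeasure_of_bounded hEm ⟨_, fun V => abs_linkE_le hB.le U V⟩
  have hint : Integrable (fun V : Cfg => linkE B U V * Real.exp (-(1 / 2 + 0) * B * wilsonAction su2Rep V))
      (configMeasure SU2 1) := by
    refine integrable_configMeasure_of_bounded (hEm.mul (Real.measurable_exp.comp (measurable_const.mul hSm)))
      ⟨Real.exp (2 * B) ^ Fintype.card (Edge 3 1) * 1, fun V => ?_⟩
    rw [abs_mul, abs_of_nonneg (linkE_pos B _ _).le, abs_of_nonneg (Real.exp_pos _).le]
    exact mul_le_mul (linkE_le hB.le _ _) (hle1 V) (Real.exp_pos _).le (by positivity)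
  exact integral_mono hint hintE fun V => by
    simpa using mul_le_mul_of_nonneg_left (hle1 V) (linkE_pos B U V).le

end Summit.QuantumFields.YangMills.Theorems.FemtoTransferGap

end
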